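import Summits.QuantumFields.BalabanUV.T4Continuum.Support.B13AvgCorrStokesVariation
import Summits.QuantumFields.BalabanUV.T4Continuum.Support.B13AvgCorrStokesLoop

/-!
# B13AvgCorrStokesVariationLoop — row NE5, J-avg-reg SECOND ORDER (owner R60 l.24769, INTENT g39-d l.24783, dagwriter Q52 (2)
# l.24813; memo `t4/T4-EST-NE5-JAVG-SECOND.md` §4 row P1-b), leaf σ-L1 «STOKES FOR DIFFERENCES», file 2∕2: THE HOLONOMIES OF A (0.4)
# LOOP WORD READ IN TWO FIELDS DIFFER BY AT MOST `(L′·|Γ| + |Γ|²∕2)·(s₁ + 2·s·t·(n + 2))`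

Cell `pub-balaban`, unit `b2b-balaban-t4-ne5-formalise-leaf-10` (NE5 formalisation swarm LEAF PROVER 10, gen 16; CLAIM σ-L1 journal
l.24964).  Summits-side NEW WORK under the LEAN PLACEMENT RULE: a [folklore] group-valued lattice calculus on OUR torus walk objects
(`T4Continuum.walk` ∕ `holAt`, the staircase and loop words `stairWord` ∕ `loopWord` of `BlockAveraging`), assembled from the two-field
swap ∕ cancellation calculus of file 1∕2 `B13AvgCorrStokesVariation` exactly as κ-L1's file 2∕2 `B13AvgCorrStokesLoop` assembles the
one-field calculus; 0 `def`, no `Prop`-valued fact minted, nothing printed asserted, no citation tag.  HONEST FRAMING: rung (B)+1 of the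
FINITE-VOLUME T⁴ programme — NOT infinite volume, NOT a mass gap, NOT the Clay problem, NOT a proof of NE5 (NOT PRINTED; GAPS G-t4-U3-1);
nothing of [Balaban1985Averaging] ∕ [Balaban1985BackgroundPropagators] ∕ [Balaban1987RG1] is instantiated or discharged here.  HONEST
DEPENDENCY (cell, verbatim): continuum YM on T⁴ ⇐ BetaPertH ∧ nine spine estimates (0/9 proved); BetaPertH ⇐ (D1) ∧ (D4) ∧ CAP+tail;
G-an2-4 gates asym, D1 and NE2/3/4.

Letters as in file 1 (`s` plaquette smallness of `U`, `s₁` plaquette variation, `t` bond variation, `hcomm`), per-swap cost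
`s₁ + 2·s·t·(n + 2)` at length budget `n`.  The TWO-FIELD DEFECT of `w` from `x` is `dist1 (holAt U′ (walk x w)·(holAt U (walk x w))⁻¹)`.
* §1 `length_loopWord` (`= 2|Γ| + 2L′`; the other length one-liners are κ-L1 file 2's `B13AvgCorrStokesLoop.length_*`, imported BY NAME);
  **`two_mul_dist1_two_stairRuns_perm`** (two staircases through the same runs in permuted order, IN CONTEXT: `2·Δ(w₁ Γ_as w₂) ≤
  2·Δ(w₁ Γ_bs w₂) + |Γ|²·C`), **`dist1_two_loopWord_le`**: for EVERY base site `x`, length `L′`, axis `μ`, offset `n`, orderings `σ, σ′`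
  and budget `N ≥ |loopWord|`: `Δ_x(loopWord L′ μ n σ σ′) ≤ (L′·|Γ| + |Γ|²∕2)·(s₁ + 2·s·t·(N + 2))` — `L′·|Γ|` swaps carry `(−c)` past
  `(−Γ^{σ′})`, the straight runs cancel in BOTH fields, `|Γ|²∕2` swaps turn `Γ^σ` into `Γ^{σ′}`, and `Γ^{σ′}(Γ^{σ′})⁻¹` has two-field
  defect `0`; `dist1_two_loopWord_le_of_bound` (`|n_ν| ≤ h`); at a coarse bond **`dist1_two_loopHol_le`**:
  `dist1 (loopHol U′ c i·(loopHol U c i)⁻¹) ≤ (d∕2 + d²∕8)·L²·(s₁ + 2·s·t·((d+2)·L + 2))`, uniform in the base site, the level, the volume.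
* the TRANSLATE instance (`U′ = U ∘ τ_v`, letters `t = m·β′∕h²`, `s₁ = m·(P1-a)`, `s` = κ-L2) is NOT taken here (σ-END ∕ P1-c).
0 sorry; axioms ⊆ {propext, Classical.choice, Quot.sound}.
-/

noncomputable section

namespace Summit.QuantumFields.BalabanUV.T4Continuum.B13AvgCorrStokesVariationLoop

open Literature.MathematicalPhysics.QuantumFieldTheory.Balaban1983to89
open Literature.MathematicalPhysics.QuantumFieldTheory.Balaban1983to89.T4Continuum
open Literature.MathematicalPhysics.QuantumFieldTheory.Balaban1983to89.B15.PrelimIntegrations (dist1_fluct_le)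
open Summit.QuantumFields.BalabanUV.T4Continuum.B13AvgCorrStokes
open Summit.QuantumFields.BalabanUV.T4Continuum.B13AvgCorrStokesVariation
open Summit.QuantumFields.BalabanUV.T4Continuum.B13AvgCorrStokesLoop

variable {P : Params} {j : ℕ} {G : Type*} [GaugeGroup G]

/-! ## §1 Lengths; staircases through the same runs; the loop words of (0.4) -/

section Stairs

/-- [folklore] the loop word of (0.4) has `2·|Γ| + 2·L′` letters. -/
theorem length_loopWord {d : ℕ} (L' : ℕ) (μ : Fin d) (n : Fin d → ℤ) (σ σ' : Equiv.Perm (Fin d)) :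
    (loopWord L' μ n σ σ').length = 2 * (stairWord σ n).length + 2 * L' := by
  simp only [loopWord, List.length_append, length_wordRev, List.length_replicate, length_stairWord]
  ring

variable (U U' : GaugeField P j G) {s s₁ t : ℝ} (hs0 : 0 ≤ s) (hs₁0 : 0 ≤ s₁) (ht0 : 0 ≤ t)
  (hcomm : ∀ a b : G, dist1 (a * b * a⁻¹ * b⁻¹) ≤ 2 * dist1 a * dist1 b)
  (hs : ∀ (y : Site P j) (μ ν : Fin P.d), μ ≠ ν →
    dist1 (U ⟨y, μ⟩ * U ⟨y.shift μ, ν⟩ * (U ⟨y.shift ν, μ⟩)⁻¹ * (U ⟨y, ν⟩)⁻¹) ≤ s)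
  (hs₁ : ∀ (y : Site P j) (μ ν : Fin P.d), μ ≠ ν →
    dist1 (U' ⟨y, μ⟩ * U' ⟨y.shift μ, ν⟩ * (U' ⟨y.shift ν, μ⟩)⁻¹ * (U' ⟨y, ν⟩)⁻¹ *
      (U ⟨y, μ⟩ * U ⟨y.shift μ, ν⟩ * (U ⟨y.shift ν, μ⟩)⁻¹ * (U ⟨y, ν⟩)⁻¹)⁻¹) ≤ s₁)
  (ht : ∀ b, dist1 (U' b * (U b)⁻¹) ≤ t)

include hs0 hs₁0 ht0 hcomm hs hs₁ ht in
/-- [folklore] **TWO STAIRCASES THROUGH THE SAME RUNS IN PERMUTED ORDER, TWO FIELDS, IN CONTEXT**: inside a word of length `≤ N`,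
replacing `Γ_bs` by `Γ_as` (`as ~ bs`) changes the two-field defect by at most `|Γ|²∕2` swaps:
`2·Δ(w₁ Γ_as w₂) ≤ 2·Δ(w₁ Γ_bs w₂) + |Γ|²·(s₁ + 2·s·t·(N+2))` — the run of the first axis of `as` is moved to the front past the runs
of `bs₁` (`|n_a|·|Γ_{bs₁}| ≤ |n_a|·|Γ′|` swaps), then induction. -/
theorem two_mul_dist1_two_stairRuns_perm (n : Fin P.d → ℤ) {N : ℕ} : ∀ (as bs : List (Fin P.d)), as.Perm bs →
    ∀ (x : Site P j) (w₁ w₂ : List (Letter P.d)), (w₁ ++ (stairRuns n as ++ w₂)).length ≤ N →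
    2 * dist1 (holAt U' (walk x (w₁ ++ (stairRuns n as ++ w₂))) * (holAt U (walk x (w₁ ++ (stairRuns n as ++ w₂))))⁻¹)
      ≤ 2 * dist1 (holAt U' (walk x (w₁ ++ (stairRuns n bs ++ w₂))) * (holAt U (walk x (w₁ ++ (stairRuns n bs ++ w₂))))⁻¹) +
        ((stairRuns n as).length : ℝ) ^ 2 * (s₁ + 2 * s * t * (N + 2))
  | [], bs, h, x, w₁, w₂, _ => by
    have hbs : bs = [] := h.symm.eq_nil
    subst hbs
    simp
  | a :: as, bs, h, x, w₁, w₂, hN => by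
    obtain ⟨bs₁, bs₂, rfl⟩ := List.append_of_mem (h.subset List.mem_cons_self)
    have h' : as.Perm (bs₁ ++ bs₂) := (h.trans List.perm_middle).cons_inv
    have eA : stairRuns n (a :: as) = axisRun a (n a) ++ stairRuns n as := rfl
    have eB : stairRuns n (bs₁ ++ a :: bs₂) = stairRuns n bs₁ ++ (axisRun a (n a) ++ stairRuns n bs₂) := by
      rw [stairRuns_append]; rfl
    have eC : stairRuns n (bs₁ ++ bs₂) = stairRuns n bs₁ ++ stairRuns n bs₂ := stairRuns_append n bs₁ bs₂
    set C := s₁ + 2 * s * t * (N + 2) with hC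
    have hC0 : 0 ≤ C := by rw [hC]; positivity
    -- lengths
    have hlenP : (stairRuns n as).length = (stairRuns n (bs₁ ++ bs₂)).length := by
      rw [length_stairRuns, length_stairRuns]; exact (h'.map _).sum_eq
    have hlen : ((stairRuns n bs₁).length : ℝ) ≤ (stairRuns n as).length := by
      rw [hlenP, eC, List.length_append]; exact_mod_cast Nat.le_add_right _ _
    -- step 1: the common first run inside the prefix, then the induction hypothesis
    have hN1 : ((w₁ ++ axisRun a (n a)) ++ (stairRuns n as ++ w₂)).length ≤ N := by
      simpa [eA, List.append_assoc] using hN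
    have h1 := two_mul_dist1_two_stairRuns_perm n as (bs₁ ++ bs₂) h' x (w₁ ++ axisRun a (n a)) w₂ hN1
    -- step 2: the run of `a` moved past the runs of `bs₁`
    have hN2 : (w₁ ++ (axisRun a (n a) ++ (stairRuns n bs₁ ++ (stairRuns n bs₂ ++ w₂)))).length ≤ N := by
      have : (w₁ ++ (axisRun a (n a) ++ (stairRuns n bs₁ ++ (stairRuns n bs₂ ++ w₂)))).length =
          ((w₁ ++ axisRun a (n a)) ++ (stairRuns n (bs₁ ++ bs₂) ++ w₂)).length := by
        simp only [List.length_append, eC]; ring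
      rw [this]
      have e2 : ((w₁ ++ axisRun a (n a)) ++ (stairRuns n (bs₁ ++ bs₂) ++ w₂)).length =
          ((w₁ ++ axisRun a (n a)) ++ (stairRuns n as ++ w₂)).length := by
        simp only [List.length_append, hlenP]
      rw [e2]; exact hN1
    have h2 := dist1_two_block_past U U' hs0 hs₁0 ht0 hcomm hs hs₁ ht x (stairRuns n bs₁) (axisRun a (n a)) w₁
      (stairRuns n bs₂ ++ w₂) hN2
    -- rewrite all words to a common shape
    have eW1 : w₁ ++ (stairRuns n (a :: as) ++ w₂) = (w₁ ++ axisRun a (n a)) ++ (stairRuns n as ++ w₂) := by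
      rw [eA]; simp [List.append_assoc]
    have eW2 : (w₁ ++ axisRun a (n a)) ++ (stairRuns n (bs₁ ++ bs₂) ++ w₂) =
        w₁ ++ (axisRun a (n a) ++ (stairRuns n bs₁ ++ (stairRuns n bs₂ ++ w₂))) := by
      rw [eC]; simp [List.append_assoc]
    have eW3 : w₁ ++ (stairRuns n (bs₁ ++ a :: bs₂) ++ w₂) = w₁ ++ (stairRuns n bs₁ ++ (axisRun a (n a) ++ (stairRuns n bs₂ ++ w₂))) := by
      rw [eB]; simp [List.append_assoc]
    rw [eW1, eW3]
    rw [eW2] at h1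
    rw [eA, List.length_append, length_axisRun, Nat.cast_add]
    rw [length_axisRun] at h2
    have hp : (0 : ℝ) ≤ ((n a).natAbs : ℝ) := Nat.cast_nonneg _
    have hq : (0 : ℝ) ≤ ((stairRuns n as).length : ℝ) := Nat.cast_nonneg _
    nlinarith [mul_nonneg (mul_nonneg hp hC0) (sub_nonneg.2 hlen), mul_nonneg (mul_nonneg hp hp) hC0,
      mul_le_mul_of_nonneg_left hlen (mul_nonneg hp hC0)]

include hs0 hs₁0 ht0 hcomm hs hs₁ ht in
/-- [folklore] **STOKES FOR DIFFERENCES — THE LOOP WORDS OF (0.4)** `Γ^σ ++ [x,x′] ++ (−Γ^{σ′}) ++ (−c)`, read from ANY base site on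
ANY level in TWO fields: with a budget `N ≥ |loopWord|`, `Δ_x(loopWord L′ μ n σ σ′) ≤ (L′·|Γ| + |Γ|²∕2)·(s₁ + 2·s·t·(N+2))` —
`L′·|Γ|` swaps carry `(−c)` past `(−Γ^{σ′})` next to `[x,x′]`, where the two straight runs cancel in both fields, `|Γ|²∕2` swaps turn
`Γ^σ` into `Γ^{σ′}`, and `Γ^{σ′}(−Γ^{σ′})` has holonomy `1` in both fields. -/
theorem dist1_two_loopWord_le (x : Site P j) (L' : ℕ) (μ : Fin P.d) (n : Fin P.d → ℤ)
    (σ σ' : Equiv.Perm (Fin P.d)) {N : ℕ} (hN : (loopWord L' μ n σ σ').length ≤ N) :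
    dist1 (holAt U' (walk x (loopWord L' μ n σ σ')) * (holAt U (walk x (loopWord L' μ n σ σ')))⁻¹)
      ≤ ((L' : ℝ) * (stairWord σ n).length + ((stairWord σ n).length : ℝ) ^ 2 / 2) * (s₁ + 2 * s * t * (N + 2)) := by
  set C := s₁ + 2 * s * t * (N + 2) with hC
  have hC0 : 0 ≤ C := by rw [hC]; positivity
  set S := stairWord σ n with hS
  set S' := stairWord σ' n with hS'
  set Pl := List.replicate L' ((μ, true) : Letter P.d) with hPl
  set Mi := List.replicate L' ((μ, false) : Letter P.d) with hMi
  have e0 : loopWord L' μ n σ σ' = (S ++ Pl) ++ (wordRev S' ++ (Mi ++ [])) := by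
    simp [loopWord, hS, hS', hPl, hMi, List.append_assoc]
  have hR : (wordRev S').length = S.length := by
    rw [length_wordRev, hS, hS', length_stairWord, length_stairWord]
  have hM : Mi.length = L' := by rw [hMi, List.length_replicate]
  have hPlL : Pl.length = L' := by rw [hPl, List.length_replicate]
  -- step 1: `(−c)` past `(−Γ′)` in both fields
  have hN1 : ((S ++ Pl) ++ (wordRev S' ++ (Mi ++ []))).length ≤ N := by rw [← e0]; exact hN
  have h1 := dist1_two_block_past U U' hs0 hs₁0 ht0 hcomm hs hs₁ ht x Mi (wordRev S') (S ++ Pl) [] hN1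
  -- step 2: `[x,x′] (−c)` cancels in both fields
  have h2 : dist1 (holAt U' (walk x ((S ++ Pl) ++ (Mi ++ (wordRev S' ++ [])))) *
      (holAt U (walk x ((S ++ Pl) ++ (Mi ++ (wordRev S' ++ [])))))⁻¹) =
      dist1 (holAt U' (walk x (S ++ wordRev S')) * (holAt U (walk x (S ++ wordRev S')))⁻¹) := by
    have := dist1_two_cancel_runs U U' x ((μ, true) : Letter P.d) L' S (wordRev S')
    simpa [hPl, hMi, List.append_assoc, Letter.flip] using this
  -- step 3: `Γ^σ` turned into `Γ^{σ′}` by `|Γ|²∕2` swaps, and `Γ^{σ′}(−Γ^{σ′})` is trivial in both fields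
  have hN3 : ([] ++ (stairRuns n ((List.finRange P.d).map σ) ++ wordRev S')).length ≤ N := by
    have e1 : ([] ++ (stairRuns n ((List.finRange P.d).map σ) ++ wordRev S')).length = 2 * S.length := by
      show ([] ++ (S ++ wordRev S')).length = 2 * S.length
      simp only [List.nil_append, List.length_append, hR]; ring
    rw [e1]
    have : 2 * S.length ≤ (loopWord L' μ n σ σ').length := by rw [length_loopWord, ← hS]; omega
    exact this.trans hN
  have h3 := two_mul_dist1_two_stairRuns_perm U U' hs0 hs₁0 ht0 hcomm hs hs₁ ht n
    ((List.finRange P.d).map σ) ((List.finRange P.d).map σ')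
    ((Equiv.Perm.map_finRange_perm σ).trans (Equiv.Perm.map_finRange_perm σ').symm) x [] (wordRev S') hN3
  have h4 : ∀ V : GaugeField P j G, holAt V (walk x (S' ++ wordRev S')) = 1 := by
    intro V
    rw [walk_append, holAt_append, holAt_walk_wordRev, mul_inv_cancel]
  have h3' : 2 * dist1 (holAt U' (walk x (S ++ wordRev S')) * (holAt U (walk x (S ++ wordRev S')))⁻¹)
      ≤ (S.length : ℝ) ^ 2 * C := by
    have e1 : ([] : List (Letter P.d)) ++ (stairRuns n ((List.finRange P.d).map σ) ++ wordRev S') = S ++ wordRev S' := rfl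
    have e2 : ([] : List (Letter P.d)) ++ (stairRuns n ((List.finRange P.d).map σ') ++ wordRev S') = S' ++ wordRev S' := rfl
    have e3 : (stairRuns n ((List.finRange P.d).map σ)).length = S.length := rfl
    rw [e1, e2, e3, h4 U, h4 U', inv_one, mul_one, GaugeGroup.dist1_one, mul_zero, zero_add] at h3
    exact h3
  -- assembly
  rw [e0]
  refine h1.trans ?_
  rw [h2, hR, hM]
  have e : ((L' : ℝ) * S.length + (S.length : ℝ) ^ 2 / 2) * C = (S.length : ℝ) * L' * C + ((S.length : ℝ) ^ 2 * C) / 2 := by ring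
  rw [e]
  linarith [h3']

include hs0 hs₁0 ht0 hcomm hs hs₁ ht in
/-- [folklore] the same with bounded offsets `|n_ν| ≤ h`: `Δ ≤ (L′·d·h + (d·h)²∕2)·(s₁ + 2·s·t·(N+2))`. -/
theorem dist1_two_loopWord_le_of_bound (x : Site P j) (L' : ℕ) (μ : Fin P.d) (n : Fin P.d → ℤ)
    (σ σ' : Equiv.Perm (Fin P.d)) {h : ℕ} (hn : ∀ ν, (n ν).natAbs ≤ h) {N : ℕ} (hN : (loopWord L' μ n σ σ').length ≤ N) :
    dist1 (holAt U' (walk x (loopWord L' μ n σ σ')) * (holAt U (walk x (loopWord L' μ n σ σ')))⁻¹)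
      ≤ ((L' : ℝ) * (P.d * h) + ((P.d : ℝ) * h) ^ 2 / 2) * (s₁ + 2 * s * t * (N + 2)) := by
  have hC0 : 0 ≤ s₁ + 2 * s * t * (N + 2) := by positivity
  refine (dist1_two_loopWord_le U U' hs0 hs₁0 ht0 hcomm hs hs₁ ht x L' μ n σ σ' hN).trans (mul_le_mul_of_nonneg_right ?_ hC0)
  have hN' : ((stairWord σ n).length : ℝ) ≤ P.d * h := by exact_mod_cast length_stairWord_le σ n hn
  have hN0 : (0 : ℝ) ≤ (stairWord σ n).length := Nat.cast_nonneg _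
  have hL : (0 : ℝ) ≤ L' := Nat.cast_nonneg _
  nlinarith [mul_le_mul_of_nonneg_left hN' hL, mul_le_mul hN' hN' hN0 (hN0.trans hN')]

include hs0 hs₁0 ht0 hcomm hs hs₁ ht in
/-- [folklore] **STOKES FOR DIFFERENCES AT A COARSE BOND — THE LOOP VARIABLES OF (0.4) READ IN TWO FIELDS** (`|n_ν| ≤ (L−1)∕2`,
straight runs of `L`, so the loop word has at most `(d+2)·L` letters):
`dist1 (loopHol U′ c i · (loopHol U c i)⁻¹) ≤ (d∕2 + d²∕8)·L²·(s₁ + 2·s·t·((d+2)·L + 2))` for every `c` and every index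
`i = (r, σ, σ′)` — uniform in the base site, the level `j`, the volume. -/
theorem dist1_two_loopHol_le (c : PBond P (j + 1)) (i : BlockAveraging.Idx P) :
    dist1 (BlockAveraging.loopHol U' c i * (BlockAveraging.loopHol U c i)⁻¹)
      ≤ ((P.d : ℝ) / 2 + (P.d : ℝ) ^ 2 / 8) * (P.L : ℝ) ^ 2 * (s₁ + 2 * s * t * (((P.d : ℝ) + 2) * P.L + 2)) := by
  have hh : ∀ ν, (BlockAveraging.off i.1 ν).natAbs ≤ (P.L - 1) / 2 := fun ν => by
    have hb := BlockAveraging.off_bounds i.1 ν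
    have : ((BlockAveraging.off i.1 ν).natAbs : ℤ) ≤ (((P.L - 1) / 2 : ℕ) : ℤ) := by
      rw [Int.natCast_natAbs]; exact abs_le.2 hb
    exact_mod_cast this
  -- the budget: `|loopWord| = 2|Γ| + 2L ≤ 2·d·(L−1)/2 + 2L ≤ (d+2)·L`
  have hlen : (loopWord P.L c.dir (BlockAveraging.off i.1) i.2.1 i.2.2).length ≤ (P.d + 2) * P.L := by
    rw [length_loopWord]
    have h1 := length_stairWord_le i.2.1 (BlockAveraging.off i.1) hh
    have h2 : 2 * ((P.L - 1) / 2) ≤ P.L := by omega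
    have h3 : 2 * (stairWord i.2.1 (BlockAveraging.off i.1)).length ≤ P.d * P.L := by
      calc 2 * (stairWord i.2.1 (BlockAveraging.off i.1)).length ≤ 2 * (P.d * ((P.L - 1) / 2)) := by omega
        _ = P.d * (2 * ((P.L - 1) / 2)) := by ring
        _ ≤ P.d * P.L := Nat.mul_le_mul_left _ h2
    nlinarith
  have hmain := dist1_two_loopWord_le_of_bound U U' hs0 hs₁0 ht0 hcomm hs hs₁ ht (emb c.src) P.L c.dir
    (BlockAveraging.off i.1) i.2.1 i.2.2 hh hlen
  refine hmain.trans ?_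
  have hcast : (((P.d + 2) * P.L : ℕ) : ℝ) = ((P.d : ℝ) + 2) * P.L := by push_cast; ring
  rw [hcast]
  have hC0 : 0 ≤ s₁ + 2 * s * t * (((P.d : ℝ) + 2) * P.L + 2) := by positivity
  refine mul_le_mul_of_nonneg_right ?_ hC0
  have h2 : (2 : ℝ) * (((P.L - 1) / 2 : ℕ) : ℝ) ≤ P.L := by
    have : 2 * ((P.L - 1) / 2) ≤ P.L := by omega
    exact_mod_cast this
  have hd : (0 : ℝ) ≤ P.d := Nat.cast_nonneg _
  have hL : (0 : ℝ) ≤ P.L := Nat.cast_nonneg _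
  have hh0 : (0 : ℝ) ≤ (((P.L - 1) / 2 : ℕ) : ℝ) := Nat.cast_nonneg _
  nlinarith [mul_le_mul_of_nonneg_left h2 (mul_nonneg hd hL), mul_le_mul h2 h2 (by positivity) hL,
    mul_nonneg hd hd]

end Stairs

end Summit.QuantumFields.BalabanUV.T4Continuum.B13AvgCorrStokesVariationLoop

end
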